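import Literature.NumberTheory.Automorphic.JacquetShalikaPairsFromLemma52
import Literature.NumberTheory.Automorphic.UnramifiedHeckeScalarsFlathProofs
import HarnessLib

/-!
# The Flath inputs of the standard `L`-function discharged; Jacquet–Shalika from Lemma (5.2) alone

Trunk `AutomorphicAxiomatic` (G19), topic `NumberTheory/Automorphic`; proof file (theorems only,
no definition, no named fact) sitting on top of

* `UnramifiedHeckeScalarsFlathProofs`, which proves the root named fact
  `exists_hasSatakeParameterAt_cofinite` of `GLnCuspidalSpectrum` (a cuspidal automorphic
  representation of `GL_n(𝔸_K)` has Satake parameters at one level `K(𝔫)` at all but finitely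
  many places; Flath, Corvallis (1979), Thm. 3; Borel–Jacquet, Corvallis (1979), §4.6 — proved
  there by the Gelfand-pair/Schur argument, `exists_hasSatakeParameterAt_cofinite_holds`), and
* `JacquetShalikaPairsFromLemma52` / `SatakeParameterTrivialBound` / `JacquetShalikaEulerProducts`,
  which reduce the Jacquet–Shalika cluster of `AutomorphicLFunction` to Lemma (5.2) of
  Jacquet–Shalika (1981) (`JacquetShalika1981_continuation_partialPairL_conj`) plus the finiteness
  of ramification (`eventually_cofinite_isUnramifiedAt`).

## Main statements (all proved)

Discharges (`theorem X_holds : X`) of the three named facts downstream of Flath's theorem: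

* `eventually_cofinite_isUnramifiedAt_holds` (`GLnCuspidalSpectrum`): a cuspidal `Π` is
  unramified at all but finitely many finite places;
* `exists_isSatakeFamilyOf_holds` (`AutomorphicLFunction`): every cuspidal `Π` has a Satake family
  off the finite set of its ramified places;
* `StandardLFunctionData.nonempty_holds` (`AutomorphicLFunction`): the hypothesis-structure
  `StandardLFunctionData Π` is inhabited;

with the pointwise dot-notation forms `CuspidalAutomorphicRepGL.eventually_isUnramifiedAt`,
`CuspidalAutomorphicRepGL.finite_setOf_not_isUnramifiedAt`,
`CuspidalAutomorphicRepGL.exists_finset_isSatakeFamilyOf`.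

The Jacquet–Shalika facts from **Lemma (5.2) alone** (one hypothesis
`h₅₂ : JacquetShalika1981_continuation_partialPairL_conj`, the Rankin–Selberg continuation of
`L_S(s, π × π̄)` to `re s > 1`, Jacquet–Shalika (1981), Lemma (5.2), p. 554):

* `absolutelyConvergent_partialStandardL_of_continuation_partialPairL` and
  `multipliable_partialStandardL_of_continuation_partialPairL` — **Thm. (5.3) with Remark (5.4)**:
  the partial standard Euler product `∏_{v ∉ S} ∏_{a ∈ α v} (1 - a q_v^{-s})⁻¹` of a cuspidal `Π`
  converges absolutely on `re s > 1`, for an *arbitrary* exceptional set `S`;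
* `StandardLFunctionData.L_eq_partialStandardL_mul_of_continuation_partialPairL` — the splitting
  `L(s, Π) = (∏_{v ∈ S} P_v(q_v^{-s})⁻¹) · L^S(s, Π)` on `re s > 1`;
* `norm_satakeParameter_le_sqrt_of_continuation_partialPairL` — **(5.1.3) at all but finitely
  many places**: off a finite set `E` of places depending only on `Π`, every Hecke–Satake parameter
  has `|a| ≤ q_v^{1/2}`;
* `JacquetShalika1981_multipliable_partialPairL_of_continuation_partialPairL` — **Thm. (5.3) for
  pairs** `∏_{v ∉ S} det(1 - q_v^{-s} A_v ⊗ A'_v)⁻¹`, from Lemma (5.2) at `GL_n` and at `GL_m`.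

After this file the named facts `multipliable_partialStandardL`,
`absolutelyConvergent_partialStandardL`, `StandardLFunctionData.L_eq_partialStandardL_mul`,
`StandardLFunctionData.multipliable_L` (`StandardLFunctionData.multipliable_L_of_lemma52'`) and
`JacquetShalika1981_multipliable_partialPairL` rest on the single named input Lemma (5.2)
(global Rankin–Selberg theory for `GL_n × GL_n`, Jacquet–Shalika (1981), §4), and
`norm_satakeParameter_le_sqrt` ((5.1.3) at *every* unramified place) additionally on Cor. (2.5)
of the source at the finitely many unramified places inside the set `S₀` of Lemma (5.2).

## References

* H. Jacquet, J. A. Shalika, *On Euler products and the classification of automorphic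
  representations I*, Amer. J. Math. 103 (1981), 499–558: Lemma (5.2), (5.1.3) (p. 554),
  Thm. (5.3) (p. 555), Remark (5.4) (p. 557) [JacquetShalikaAJM1981].
* D. Flath, *Decomposition of representations into tensor products*, Proc. Sympos. Pure Math. 33
  (Corvallis 1979), part 1, Thm. 3 [FlathCorvallis1979].
* A. Borel, H. Jacquet, *Automorphic forms and automorphic representations*, Proc. Sympos. Pure
  Math. 33 (Corvallis 1979), part 1, §4.6 [BorelJacquetCorvallis1979].
-/

noncomputable section

open NumberField IsDedekindDomain MeasureTheory

namespace Literature.NumberTheory.Automorphic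

/-! ### The three Flath consequences, discharged -/

section Flath

variable {n : ℕ} {K : Type} [Field K] [NumberField K]
  {μ : Measure (AdelicGroupData.gl n K).automorphicQuotient}
  [(AdelicGroupData.gl n K).IsAutomorphicMeasure μ]

/-- **A cuspidal automorphic representation of `GL_n(𝔸_K)` is unramified at all but finitely many
finite places** — the named fact `eventually_cofinite_isUnramifiedAt` of `GLnCuspidalSpectrum`,
now a theorem: `exists_hasSatakeParameterAt_cofinite_holds` (Flath (1979), Thm. 3, proved in
`UnramifiedHeckeScalarsFlathProofs`) and the finiteness of the prime divisors of the level
(`eventually_cofinite_isUnramifiedAt_of_exists_hasSatakeParameterAt_cofinite`).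
[cite: FlathCorvallis1979, Thm. 3] [cite: BorelJacquetCorvallis1979, §4.6] -/
theorem eventually_cofinite_isUnramifiedAt_holds :
    eventually_cofinite_isUnramifiedAt (n := n) (K := K) (μ := μ) :=
  eventually_cofinite_isUnramifiedAt_of_exists_hasSatakeParameterAt_cofinite
    exists_hasSatakeParameterAt_cofinite_holds

/-- **Every cuspidal `Π` has a Satake family off the finite set of its ramified places** — the
named fact `exists_isSatakeFamilyOf` of `AutomorphicLFunction`, now a theorem
(`exists_isSatakeFamilyOf_of_eventually_cofinite` fed with
`eventually_cofinite_isUnramifiedAt_holds`; Flath (1979), Thm. 3; Borel–Jacquet (1979), §4.6).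
[cite: FlathCorvallis1979, Thm. 3] [cite: BorelJacquetCorvallis1979, §4.6] -/
theorem exists_isSatakeFamilyOf_holds : exists_isSatakeFamilyOf (n := n) (K := K) (μ := μ) :=
  exists_isSatakeFamilyOf_of_eventually_cofinite eventually_cofinite_isUnramifiedAt_holds

/-- **The hypothesis-structure `StandardLFunctionData Π` is inhabited for every cuspidal `Π`** —
the named fact `StandardLFunctionData.nonempty` of `AutomorphicLFunction`, now a theorem
(`StandardLFunctionData.nonempty_of_eventually_cofinite` fed with
`eventually_cofinite_isUnramifiedAt_holds`; Flath (1979), Thm. 3; Borel–Jacquet (1979), §4.6).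
[cite: FlathCorvallis1979, Thm. 3] [cite: BorelJacquetCorvallis1979, §4.6] -/
theorem StandardLFunctionData.nonempty_holds :
    StandardLFunctionData.nonempty (n := n) (K := K) (μ := μ) :=
  StandardLFunctionData.nonempty_of_eventually_cofinite eventually_cofinite_isUnramifiedAt_holds

/-- Pointwise forms for one cuspidal `Π` (dot notation): `Π` is unramified at all but finitely many
finite places. [cite: BorelJacquetCorvallis1979, §4.6] -/
theorem CuspidalAutomorphicRepGL.eventually_isUnramifiedAt (P : CuspidalAutomorphicRepGL n K μ) :
    ∀ᶠ v in Filter.cofinite, IsUnramifiedAt P.1 v :=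
  eventually_cofinite_isUnramifiedAt_holds P

/-- The set of finite places at which a cuspidal `Π` is ramified is finite.
[cite: BorelJacquetCorvallis1979, §4.6] -/
theorem CuspidalAutomorphicRepGL.finite_setOf_not_isUnramifiedAt
    (P : CuspidalAutomorphicRepGL n K μ) :
    {v : HeightOneSpectrum (𝓞 K) | ¬ IsUnramifiedAt P.1 v}.Finite :=
  eventually_cofinite_isUnramifiedAt_holds P

/-- Every cuspidal `Π` has a Satake family off a finite set of places consisting of ramified places
(pointwise form of `exists_isSatakeFamilyOf_holds`). [cite: BorelJacquetCorvallis1979, §4.6] -/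
theorem CuspidalAutomorphicRepGL.exists_finset_isSatakeFamilyOf
    (P : CuspidalAutomorphicRepGL n K μ) :
    ∃ (S : Finset (HeightOneSpectrum (𝓞 K))) (α : SatakeFamily K),
      (∀ v ∈ S, ¬ IsUnramifiedAt P.1 v) ∧ IsSatakeFamilyOf P ↑S α :=
  exists_isSatakeFamilyOf_holds P

end Flath

/-! ### The Jacquet–Shalika facts from Lemma (5.2) alone -/

section Lemma52

variable {n : ℕ} {K : Type} [Field K] [NumberField K]
  {μ : Measure (AdelicGroupData.gl n K).automorphicQuotient}
  [(AdelicGroupData.gl n K).IsAutomorphicMeasure μ]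

/-- **Jacquet–Shalika, Thm. (5.3) with Remark (5.4), from Lemma (5.2) alone: absolute
convergence.** For every Satake family `α` of a cuspidal `Π` off an arbitrary `S`,
`∑_{v ∉ S} ‖(∏_{a ∈ α v} (1 - a q_v^{-s}))⁻¹ - 1‖ < ∞` on `re s > 1`
(`absolutelyConvergent_partialStandardL_of_lemma52'` of `SatakeParameterTrivialBound` with its
Flath input discharged by `eventually_cofinite_isUnramifiedAt_holds`).
[cite: JacquetShalikaAJM1981, Thm. (5.3), Remark (5.4), Lemma (5.2)] -/
theorem absolutelyConvergent_partialStandardL_of_continuation_partialPairL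
    (h₅₂ : JacquetShalika1981_continuation_partialPairL_conj (μ := μ)) :
    absolutelyConvergent_partialStandardL (μ := μ) :=
  absolutelyConvergent_partialStandardL_of_lemma52' h₅₂ eventually_cofinite_isUnramifiedAt_holds

/-- **Jacquet–Shalika, Thm. (5.3), from Lemma (5.2) alone: the named fact
`multipliable_partialStandardL`.** The partial standard Euler product
`∏_{v ∉ S} ∏_{a ∈ α v} (1 - a q_v^{-s})⁻¹` of a cuspidal `Π` is multipliable on `re s > 1`, for an
arbitrary exceptional set `S` (`multipliable_partialStandardL_of_lemma52_of_cofinite` of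
`JacquetShalikaPairsFromLemma52` with its Flath input discharged by
`exists_hasSatakeParameterAt_cofinite_holds`). The remaining hypothesis is the Rankin–Selberg
continuation of `L_S(s, π × π̄)` to `re s > 1` (loc. cit. Lemma (5.2), p. 554, §4).
[cite: JacquetShalikaAJM1981, Thm. (5.3), Lemma (5.2)] -/
theorem multipliable_partialStandardL_of_continuation_partialPairL
    (h₅₂ : JacquetShalika1981_continuation_partialPairL_conj (μ := μ)) :
    multipliable_partialStandardL (μ := μ) :=
  multipliable_partialStandardL_of_lemma52_of_cofinite h₅₂
    exists_hasSatakeParameterAt_cofinite_holds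

/-- **The splitting `L(s, Π) = (∏_{v ∈ S} P_v(q_v^{-s})⁻¹) · L^S(s, Π)` on `re s > 1`** (the named
fact `StandardLFunctionData.L_eq_partialStandardL_mul`) from Lemma (5.2) alone
(`StandardLFunctionData.L_eq_partialStandardL_mul_of_lemma52'` with its Flath input discharged).
[cite: JacquetShalikaAJM1981, Thm. (5.3), Lemma (5.2)] -/
theorem StandardLFunctionData.L_eq_partialStandardL_mul_of_continuation_partialPairL
    {P : CuspidalAutomorphicRepGL n K μ}
    (h₅₂ : JacquetShalika1981_continuation_partialPairL_conj (μ := μ)) :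
    StandardLFunctionData.L_eq_partialStandardL_mul (P := P) :=
  StandardLFunctionData.L_eq_partialStandardL_mul_of_lemma52' h₅₂
    eventually_cofinite_isUnramifiedAt_holds

/-- **(5.1.3) at all but finitely many places, from Lemma (5.2) alone.** For a cuspidal `Π` there
is a finite set `E` of finite places such that every Hecke–Satake parameter `a ∈ α v` of every
Satake family `α` of `Π` off any `S` satisfies `|a| ≤ q_v^{1/2}` for `v ∉ S ∪ E`
(`norm_satakeParameter_le_sqrt_of_lemma52_of_not_mem` with its Flath input discharged). At the
finitely many unramified places inside `E` the bound is Cor. (2.5) of the source (the named fact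
`norm_satakeParameter_le_sqrt`), on which Lemma (5.2) is silent.
[cite: JacquetShalikaAJM1981, (5.1.3), Lemma (5.2)] -/
theorem norm_satakeParameter_le_sqrt_of_continuation_partialPairL
    (h₅₂ : JacquetShalika1981_continuation_partialPairL_conj (μ := μ))
    (P : CuspidalAutomorphicRepGL n K μ) :
    ∃ E : Finset (HeightOneSpectrum (𝓞 K)), ∀ ⦃S : Set (HeightOneSpectrum (𝓞 K))⦄
      ⦃α : SatakeFamily K⦄, IsSatakeFamilyOf P S α → ∀ ⦃v : HeightOneSpectrum (𝓞 K)⦄,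
        v ∉ S → v ∉ E → ∀ ⦃a : ℂ⦄, a ∈ α v → ‖a‖ ≤ Real.sqrt v.residueCard :=
  norm_satakeParameter_le_sqrt_of_lemma52_of_not_mem h₅₂ eventually_cofinite_isUnramifiedAt_holds P

end Lemma52

/-! ### Theorem (5.3) for pairs from Lemma (5.2) at `GL_n` and at `GL_m` alone -/

section Pairs

variable {n m : ℕ} {K : Type} [Field K] [NumberField K]
  {μ : Measure (AdelicGroupData.gl n K).automorphicQuotient}
  [(AdelicGroupData.gl n K).IsAutomorphicMeasure μ]
  {μ' : Measure (AdelicGroupData.gl m K).automorphicQuotient}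
  [(AdelicGroupData.gl m K).IsAutomorphicMeasure μ']

/-- **Jacquet–Shalika's Thm. (5.3) for pairs from Lemma (5.2) alone** (at `GL_n` and at `GL_m`):
the Euler product `∏_{v ∉ S} det(1 - q_v^{-s} A_v ⊗ A'_v)⁻¹` of two cuspidal representations is
multipliable on `re s > 1` (the named fact `JacquetShalika1981_multipliable_partialPairL` of
`PairLFunctionBaseChange`; `JacquetShalika1981_multipliable_partialPairL_of_lemma52_of_cofinite`
with both Flath inputs discharged by `exists_hasSatakeParameterAt_cofinite_holds`).
[cite: JacquetShalikaAJM1981, Thm. (5.3), Lemma (5.2)] -/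
theorem JacquetShalika1981_multipliable_partialPairL_of_continuation_partialPairL
    (h₅₂ : JacquetShalika1981_continuation_partialPairL_conj (μ := μ))
    (h₅₂' : JacquetShalika1981_continuation_partialPairL_conj (μ := μ')) :
    JacquetShalika1981_multipliable_partialPairL (n := n) (m := m) (K := K) (μ := μ) (μ' := μ') :=
  JacquetShalika1981_multipliable_partialPairL_of_lemma52_of_cofinite h₅₂
    exists_hasSatakeParameterAt_cofinite_holds h₅₂' exists_hasSatakeParameterAt_cofinite_holds

end Pairs

end Literature.NumberTheory.Automorphic
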